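import Mathlib
import Summits.NavierStokesRegularity.NavierStokesRegularity.Theorems.BarrierStepRungThreeBarrierSoundnessTools
import Summits.NavierStokesRegularity.NavierStokesRegularity.Theorems.BarrierStepRungThreeBarrierSoundnessTailsLow
import Summits.NavierStokesRegularity.NavierStokesRegularity.Theorems.BarrierStepRungThreeBarrierSoundnessTailsUp
import HarnessLib

/-!
# `BarrierSoundness` (route `BarrierStepRungThree`), tools III: from the certificate clauses to
  RATES along a pseudo-flow, STRICT caps, and the upper tail from the top window shell

Helper lemmas for item stmt-NavierStokesRegularity-23421 (`BarrierSoundness`, repaired form K2′). The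
certificate of route `BarrierStepRungThree` is a list of POINTWISE clauses on the window amplitudes
(window `[kLo, kLo+n)`, clock/barrier `v`, goal `g`, caps `Φ`, outside profile `(r, q, ρ)`). Here those
clauses are turned into statements ALONG an `(η, η)`-pseudo-flow (`TaoCascade.PseudoFlowOn τ 1 α η η …`):

* `clock_rate_of_clauses` — ROBUST DECREASE (clause 23) at a REGION state with `g > 0` gives the clock
  rate `Dv(win S(u))·(win S)'(u) ≤ -γ`, the defect `S' - quadTerm` on the window being a disturbance in
  the certified box `|d| ≤ η 4^k √Φ` by (4.8);
* `lower_rate_of_clauses` — TAIL RATE (clause 24, below the window) at a REGION state gives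
  `F'_{i,k} ≤ ρ_k √(2 F_{i,k})` by (4.9)–(4.10);
* `window_cap_lt` — while `v ≤ 0` (properness `|x| ≤ M`) and the window caps hold on `[0, s]`, `s ≤ c`,
  (4.10) with admissible slack gives the STRICT cap `F_{i,kLo+j}(s) < Φ_j` (clause 17);
* `lower_cap_lt` — the square-root Grönwall bound and `r_k + c ρ_k ≤ q_k`, `r_k < q_k` give the STRICT cap
  `F_{i,k}(s) < q_k²/2` for `s < c`;
* `upper_tail_of_window` — the tail sums above the window stay `≤ q_k²/2` on `[0, t]` (`t ≤ c`) as soon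
  as the TOP window shell obeys `F ≤ q_{kLo+n-1}²/2` there (one-directional induction of tools II).

HONEST FRAMING: MODEL lattice bookkeeping only (Tao 2016 §4, §6); nothing here is a statement about the
Navier–Stokes equations; the route's rung leaf (`TaoLadderRungThree.Target`, TL-M3) is not the summit
Statement.
-/

noncomputable section

-- the sub-problem namespace `Summit.NavierStokesRegularity.NavierStokesRegularity` repeats the summit name by design (D-0017)
set_option linter.dupNamespace false

namespace Summit.NavierStokesRegularity.NavierStokesRegularity.Theorems

namespace BarrierSoundness

open Set MeasureTheory intervalIntegral Filter Topology
open Literature.Analysis.FluidPDE Literature.Analysis.FluidPDE.TaoCascade GappedFrontRobust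

variable {τ η : ℝ} {α : Fin 4 → Fin 4 → Fin 4 → ℤ × ℤ × ℤ → ℝ}
  {S₀ F₀ B₀ : Fin 4 → ℤ → ℝ} {S F : Fin 4 → ℤ → ℝ → ℝ} {n : ℕ} {kLo : ℤ}
  {v g : (Fin 4 → Fin n → ℝ) → ℝ} {r q ρ : ℤ → ℝ} {Φ : Fin n → ℝ}
  {win : (Fin 4 → ℤ → ℝ) → (Fin 4 → Fin n → ℝ)} {vf : (Fin 4 → ℤ → ℝ) → (Fin 4 → ℤ → ℝ)}

/-! ### The quadratic term along a flow -/

/-- The certificate's vector field `vf` (the quadratic term of a time-independent state, read at time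
`0`) evaluated at the time-`u` slice of a flow is the quadratic term of the flow at time `u`.
[cite: Tao2016AveragedNS, §4 (4.8)] -/
theorem vf_slice_eq_quadTerm
    (hvf : ∀ (S : Fin 4 → ℤ → ℝ) (i : Fin 4) (k : ℤ), vf S i k = Literature.Analysis.FluidPDE.TaoCascade.quadTerm 1 α (fun i' k' (_ : ℝ) => S i' k') i k 0)
    (u : ℝ) (i : Fin 4) (k : ℤ) :
    vf (fun i k => S i k u) i k = quadTerm 1 α S i k u := by
  rw [hvf]
  simp only [quadTerm]

/-! ### Rates along the flow from the pointwise clauses -/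

/-- **Clock rate from ROBUST DECREASE.** Along an `(η, η)`-pseudo-flow, at a time `u` where the state
is a REGION state of the certificate and `g > 0`, the clock observable `v ∘ win` decreases at rate
`≥ γ`: the window components of `S' = quadTerm + (S' - quadTerm)` form the certified vector field plus a
disturbance with `|d_{i,j}| ≤ η 4^{kLo+j} √(F_{i,kLo+j}) ≤ η 4^{kLo+j} √Φ_j` by (4.8).
[cite: Tao2016AveragedNS, §4 Lemma 4.1 (4.8); doi:10.1137/050645178 §3.4 (robust decrease)] -/
theorem clock_rate_of_clauses {γ : ℝ} (hflow : PseudoFlowOn τ 1 α η η S₀ F₀ B₀ S F) (hη : 0 ≤ η)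
    {u : ℝ} (hu : u ∈ Icc 0 τ)
    (hwin : ∀ (S : Fin 4 → ℤ → ℝ) (i : Fin 4) (j : Fin n), win S i j = S i (kLo + (j : ℕ)))
    (hvf : ∀ (S : Fin 4 → ℤ → ℝ) (i : Fin 4) (k : ℤ), vf S i k = Literature.Analysis.FluidPDE.TaoCascade.quadTerm 1 α (fun i' k' (_ : ℝ) => S i' k') i k 0)
    (hdec : (∀ (S F : Fin 4 → ℤ → ℝ) (d : Fin 4 → Fin n → ℝ), (v (win S) ≤ 0 ∧ (∀ i k, S i k ^ 2 ≤ 2 * F i k) ∧ (∀ i k, 0 ≤ F i k) ∧ (∀ i k, (k < kLo ∨ kLo + n ≤ k) → F i k ≤ q k ^ 2 / 2) ∧ (∀ (i : Fin 4) (j : Fin n), F i (kLo + (j : ℕ)) ≤ Φ j)) → 0 < g (win S) → (∀ (i : Fin 4) (j : Fin n), |d i j| ≤ η * (1 + 1 : ℝ) ^ ((2 : ℝ) * ((kLo + (j : ℕ) : ℤ) : ℝ)) * Real.sqrt (Φ j)) → (fderiv ℝ v (win S)) (fun i j => vf S i (kLo + (j : ℕ)) + d i j) ≤ -γ))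
    (hreg : (v (win (fun i k => S i k u)) ≤ 0 ∧ (∀ i k, (fun i k => S i k u) i k ^ 2 ≤ 2 * (fun i k => F i k u) i k) ∧ (∀ i k, 0 ≤ (fun i k => F i k u) i k) ∧ (∀ i k, (k < kLo ∨ kLo + n ≤ k) → (fun i k => F i k u) i k ≤ q k ^ 2 / 2) ∧ (∀ (i : Fin 4) (j : Fin n), (fun i k => F i k u) i (kLo + (j : ℕ)) ≤ Φ j)))
    (hgpos : 0 < g (win (fun i k => S i k u))) :
    (fderiv ℝ v (fun i (j : Fin n) => S i (kLo + (j : ℕ)) u))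
      (fun i (j : Fin n) => derivWithin (S i (kLo + (j : ℕ))) (Icc 0 τ) u) ≤ -γ := by
  -- the disturbance: window defect of the equation of motion
  set d : Fin 4 → Fin n → ℝ := fun i j =>
    derivWithin (S i (kLo + (j : ℕ))) (Icc 0 τ) u - vf (fun i k => S i k u) i (kLo + (j : ℕ)) with hd
  have hΦcap : ∀ (i : Fin 4) (j : Fin n), F i (kLo + (j : ℕ)) u ≤ Φ j := hreg.2.2.2.2
  have hdbox : ∀ (i : Fin 4) (j : Fin n),
      |d i j| ≤ η * (1 + 1 : ℝ) ^ ((2 : ℝ) * ((kLo + (j : ℕ) : ℤ) : ℝ)) * Real.sqrt (Φ j) := by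
    intro i j
    have hm := hflow.motion i (kLo + (j : ℕ)) u hu
    simp only [Int.cast_add, Int.cast_natCast] at hm
    have hd' : d i j = derivWithin (S i (kLo + (j : ℕ))) (Icc 0 τ) u -
        quadTerm 1 α S i (kLo + (j : ℕ)) u := by
      simp only [hd, vf_slice_eq_quadTerm hvf]
    rw [hd']
    refine hm.trans ?_
    have hpow : 0 ≤ η * (1 + 1 : ℝ) ^ ((2 : ℝ) * ((kLo : ℝ) + ((j : ℕ) : ℝ))) := by positivity
    have h2 := mul_le_mul_of_nonneg_left (Real.sqrt_le_sqrt (hΦcap i j)) hpow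
    push_cast at h2 ⊢
    exact h2
  have h := hdec (fun i k => S i k u) (fun i k => F i k u) d hreg hgpos hdbox
  have hw : win (fun i k => S i k u) = fun i (j : Fin n) => S i (kLo + (j : ℕ)) u :=
    funext fun i => funext fun j => hwin _ i j
  have hsum : (fun i (j : Fin n) => vf (fun i k => S i k u) i (kLo + (j : ℕ)) + d i j) =
      fun i (j : Fin n) => derivWithin (S i (kLo + (j : ℕ))) (Icc 0 τ) u := by
    funext i j
    simp only [hd]
    ring
  rw [hw, hsum] at h
  exact h

/-- **Energy rate below the window from TAIL RATE.** Along an `(η, η)`-pseudo-flow, at a time `u`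
where the state is a REGION state, every mode `(i, k)` below the window (`k < kLo`) obeys
`F'_{i,k} ≤ ρ_k √(2 F_{i,k})`: (4.9) has no defect term, the certificate bounds `quadTerm·S ≤ ρ|S|`, and
`|S| ≤ √(2F)` by (4.10). [cite: Tao2016AveragedNS, §4 Lemma 4.1 (4.9)–(4.10)] -/
theorem lower_rate_of_clauses (hflow : PseudoFlowOn τ 1 α η η S₀ F₀ B₀ S F) {u : ℝ}
    (hu : u ∈ Icc 0 τ)
    (hvf : ∀ (S : Fin 4 → ℤ → ℝ) (i : Fin 4) (k : ℤ), vf S i k = Literature.Analysis.FluidPDE.TaoCascade.quadTerm 1 α (fun i' k' (_ : ℝ) => S i' k') i k 0)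
    (htail : (∀ (S F : Fin 4 → ℤ → ℝ), (v (win S) ≤ 0 ∧ (∀ i k, S i k ^ 2 ≤ 2 * F i k) ∧ (∀ i k, 0 ≤ F i k) ∧ (∀ i k, (k < kLo ∨ kLo + n ≤ k) → F i k ≤ q k ^ 2 / 2) ∧ (∀ (i : Fin 4) (j : Fin n), F i (kLo + (j : ℕ)) ≤ Φ j)) → ∀ (i : Fin 4) (k : ℤ), k < kLo → vf S i k * S i k ≤ ρ k * |S i k|))
    (hreg : (v (win (fun i k => S i k u)) ≤ 0 ∧ (∀ i k, (fun i k => S i k u) i k ^ 2 ≤ 2 * (fun i k => F i k u) i k) ∧ (∀ i k, 0 ≤ (fun i k => F i k u) i k) ∧ (∀ i k, (k < kLo ∨ kLo + n ≤ k) → (fun i k => F i k u) i k ≤ q k ^ 2 / 2) ∧ (∀ (i : Fin 4) (j : Fin n), (fun i k => F i k u) i (kLo + (j : ℕ)) ≤ Φ j)))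
    {i : Fin 4} {k : ℤ} (hk : k < kLo) (hρ : 0 ≤ ρ k) :
    derivWithin (F i k) (Icc 0 τ) u ≤ ρ k * Real.sqrt (2 * F i k u) := by
  have h1 := hflow.energy i k u hu
  have h2 := htail (fun i k => S i k u) (fun i k => F i k u) hreg i k hk
  rw [vf_slice_eq_quadTerm hvf] at h2
  have h3 : |S i k u| ≤ Real.sqrt (2 * F i k u) :=
    Real.abs_le_sqrt (by linarith [hflow.defect_lower i k u hu])
  calc derivWithin (F i k) (Icc 0 τ) u ≤ quadTerm 1 α S i k u * S i k u := h1
    _ ≤ ρ k * |S i k u| := h2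
    _ ≤ ρ k * Real.sqrt (2 * F i k u) := mul_le_mul_of_nonneg_left h3 hρ

/-! ### Strict caps -/

/-- **Strict window cap from (4.10) and the slack budget.** Along an `(η, η)`-pseudo-flow with
admissible slack `B₀ ≤ η · slackWeight ≤ η Ψ`, if at time `s ≤ c` the window amplitude is `≤ M` in
modulus and the cap `F_{i,kLo+j} ≤ Φ_j` held on `[0, s]`, then (4.10) gives
`F_{i,kLo+j}(s) ≤ M²/2 + η Ψ + η 4^{kLo+j} c Φ_j < Φ_j` (clause 17 of the certificate): the cap is STRICT.
[cite: Tao2016AveragedNS, §4 Lemma 4.1 (4.10) and §6.4 Lemma 6.7] -/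
theorem window_cap_lt (hflow : PseudoFlowOn τ 1 α η η S₀ F₀ B₀ S F) (hη : 0 < η) {θ c M : ℝ}
    {env Ψ : ℤ → ℝ} {Lp : ℕ}
    (hB : ∀ i k, 0 ≤ B₀ i k ∧ B₀ i k ≤ η * slackWeight 1 θ c env Lp k)
    (hΨ : ∀ (L' : ℕ) (k : ℤ), slackWeight 1 θ c env L' k ≤ Ψ k)
    {j : Fin n} (hΦ0 : 0 ≤ Φ j)
    (hΦj : M ^ 2 / 2 + η * Ψ (kLo + (j : ℕ)) +
      η * (1 + 1 : ℝ) ^ ((2 : ℝ) * ((kLo + (j : ℕ) : ℤ) : ℝ)) * c * Φ j < Φ j)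
    {i : Fin 4} {s : ℝ} (hs : s ∈ Icc 0 τ) (hsc : s ≤ c)
    (hM : |S i (kLo + (j : ℕ)) s| ≤ M) (hcap : ∀ u ∈ Icc 0 s, F i (kLo + (j : ℕ)) u ≤ Φ j) :
    F i (kLo + (j : ℕ)) s < Φ j := by
  have hup := hflow.defect_upper i (kLo + (j : ℕ)) s hs
  -- ½ S² ≤ M²/2
  have h1 : (1 / 2) * S i (kLo + (j : ℕ)) s ^ 2 ≤ M ^ 2 / 2 := by
    have hM0 : 0 ≤ M := (abs_nonneg _).trans hM
    have := sq_le_sq' (abs_le.mp hM).1 (abs_le.mp hM).2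
    linarith
  -- B₀ ≤ η Ψ
  have h2 : B₀ i (kLo + (j : ℕ)) ≤ η * Ψ (kLo + (j : ℕ)) :=
    (hB i _).2.trans (mul_le_mul_of_nonneg_left (hΨ Lp _) hη.le)
  -- ∫₀^s F ≤ c Φ
  have hFc : ContinuousOn (F i (kLo + (j : ℕ))) (Icc 0 τ) := (hflow.contDiffOn_F i _).continuousOn
  have hsub : uIcc 0 s ⊆ Icc 0 τ := by
    rw [uIcc_of_le hs.1]
    exact Icc_subset_Icc_right hs.2
  have h3 : ∫ u in (0 : ℝ)..s, F i (kLo + (j : ℕ)) u ≤ c * Φ j := by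
    have hint : IntervalIntegrable (F i (kLo + (j : ℕ))) volume 0 s := (hFc.mono hsub).intervalIntegrable
    have hle := intervalIntegral.integral_mono_on hs.1 hint intervalIntegrable_const
      fun u hu => hcap u hu
    simp only [intervalIntegral.integral_const, sub_zero, smul_eq_mul] at hle
    calc ∫ u in (0 : ℝ)..s, F i (kLo + (j : ℕ)) u ≤ s * Φ j := hle
      _ ≤ c * Φ j := mul_le_mul_of_nonneg_right hsc hΦ0
  have hpow : 0 < (1 + 1 : ℝ) ^ ((2 : ℝ) * ((kLo + (j : ℕ) : ℤ) : ℝ)) :=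
    Real.rpow_pos_of_pos (by norm_num) _
  have h4 : η * (1 + 1 : ℝ) ^ ((2 : ℝ) * ((kLo + (j : ℕ) : ℤ) : ℝ)) *
      ∫ u in (0 : ℝ)..s, F i (kLo + (j : ℕ)) u ≤
      η * (1 + 1 : ℝ) ^ ((2 : ℝ) * ((kLo + (j : ℕ) : ℤ) : ℝ)) * (c * Φ j) :=
    mul_le_mul_of_nonneg_left h3 (by positivity)
  have h5 := hup.trans (add_le_add (add_le_add h1 h2) h4)
  have h6 : M ^ 2 / 2 + η * Ψ (kLo + (j : ℕ)) +
      η * (1 + 1 : ℝ) ^ ((2 : ℝ) * ((kLo + (j : ℕ) : ℤ) : ℝ)) * (c * Φ j) =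
      M ^ 2 / 2 + η * Ψ (kLo + (j : ℕ)) +
      η * (1 + 1 : ℝ) ^ ((2 : ℝ) * ((kLo + (j : ℕ) : ℤ) : ℝ)) * c * Φ j := by ring
  rw [h6] at h5
  exact lt_of_le_of_lt h5 hΦj

/-- **Strict cap below the window from the square-root Grönwall bound.** Along an `(η, η)`-pseudo-flow
(`τ > 0`), if the mode `(i, k)` starts with `F₀ ≤ r_k²/2`, obeys the rate bound `F' ≤ ρ_k √(2F)` on
`[0, t]` (`t ≤ τ`, `t < c`), and the profile satisfies `0 ≤ r_k < q_k`, `ρ_k ≥ 0`, `r_k + c ρ_k ≤ q_k`,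
then `F_{i,k}(s) < q_k²/2` on `[0, t]` (`√F ≤ (r_k + ρ_k s)/√2 < q_k/√2`).
[cite: Tao2016AveragedNS, §4 Lemma 4.1 (4.9)–(4.10)] -/
theorem lower_cap_lt (hflow : PseudoFlowOn τ 1 α η η S₀ F₀ B₀ S F) (hτ : 0 < τ) {c : ℝ}
    {i : Fin 4} {k : ℤ} (hprofk : 0 ≤ r k ∧ r k < q k ∧ 0 ≤ ρ k ∧ r k + c * ρ k ≤ q k)
    (hF0 : F₀ i k ≤ r k ^ 2 / 2) {t : ℝ} (ht : t ≤ τ) (htc : t < c)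
    (hrate : ∀ u ∈ Icc 0 t, derivWithin (F i k) (Icc 0 τ) u ≤ ρ k * Real.sqrt (2 * F i k u))
    {s : ℝ} (hs : s ∈ Icc 0 t) : F i k s < q k ^ 2 / 2 := by
  obtain ⟨hr0, hrq, hρ0, hrcq⟩ := hprofk
  have hs2 : (0 : ℝ) < Real.sqrt 2 := by positivity
  have h := sqrt_energy_le_of_rate hflow hτ ht i k hρ0 hrate s hs
  have hF0' : Real.sqrt (F₀ i k) ≤ r k / Real.sqrt 2 := by
    have : Real.sqrt (F₀ i k) ≤ Real.sqrt (r k ^ 2 / 2) := Real.sqrt_le_sqrt hF0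
    rwa [Real.sqrt_div' _ (by norm_num : (0:ℝ) ≤ 2), Real.sqrt_sq hr0] at this
  -- r + ρ s < q
  have hstrict : r k + ρ k * s < q k := by
    rcases hρ0.eq_or_lt with hρ | hρ
    · rw [← hρ]; simpa using hrq
    · have : ρ k * s < ρ k * c := mul_lt_mul_of_pos_left (lt_of_le_of_lt hs.2 htc) hρ
      linarith
  have hsqrt_lt : Real.sqrt (F i k s) < q k / Real.sqrt 2 := by
    have h1 : Real.sqrt (F i k s) ≤ (r k + ρ k * s) / Real.sqrt 2 := by
      rw [add_div]
      have : ρ k * s / Real.sqrt 2 = ρ k * s / Real.sqrt 2 := rfl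
      linarith
    exact lt_of_le_of_lt h1 (div_lt_div_of_pos_right hstrict hs2)
  have hsτ : s ∈ Icc 0 τ := ⟨hs.1, hs.2.trans ht⟩
  have hF := hflow.nonneg_F i k s hsτ
  have hq0 : 0 < q k / Real.sqrt 2 := lt_of_le_of_lt (Real.sqrt_nonneg _) hsqrt_lt
  calc F i k s = Real.sqrt (F i k s) ^ 2 := (Real.sq_sqrt hF).symm
    _ < (q k / Real.sqrt 2) ^ 2 := by
        exact pow_lt_pow_left₀ hsqrt_lt (Real.sqrt_nonneg _) two_ne_zero
    _ = q k ^ 2 / 2 := by rw [div_pow, Real.sq_sqrt (by norm_num : (0:ℝ) ≤ 2)]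

/-! ### The upper tail from the top window shell -/

/-- **Upper tail caps from the top window shell.** Along an `(η, η)`-pseudo-flow (`τ > 0`,
cancelling table), let the profile above the window `[kLo, kLo+n)` satisfy `0 ≤ r_k`,
`r_k + c ρ_k ≤ q_k` and the recursion `2^{5(k-1)/2} (∑|α_{·,(0,0,1)}|) q_{k-1}² ≤ ρ_k` (`k ≥ kLo+n`),
`q_{kLo+n-1} ≥ 0`, and let the START tail sums above every `k ≥ kLo+n` be `≤ r_k²/2`. If on `[0, t]`
(`t ≤ c`) the top window shell obeys `F_{i,kLo+n-1} ≤ q_{kLo+n-1}²/2`, then every tail sum above every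
`k ≥ kLo+n` is `≤ q_k²/2` on `[0, t]` (tools II-b on the flow restricted to `[0, t]`).
[cite: Tao2016AveragedNS, §4 Lemma 4.1 (4.5), (4.9)–(4.10) with (4.3)] -/
theorem upper_tail_of_window (hflow : PseudoFlowOn τ 1 α η η S₀ F₀ B₀ S F) (hα : IsCancellingCoeff α)
    {c : ℝ}
    (hprof' : ∀ k : ℤ, kLo + n ≤ k → 0 ≤ r k ∧ r k + c * ρ k ≤ q k ∧
      (1 + 1 : ℝ) ^ ((5 : ℝ) * (k - 1 : ℤ) / 2) * (∑ i₁, ∑ i₂, ∑ i₃, |α i₁ i₂ i₃ (0, 0, 1)|) *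
        q (k - 1) ^ 2 ≤ ρ k)
    (hqtop : 0 ≤ q (kLo + n - 1))
    (hstart : ∀ k : ℤ, kLo + n ≤ k → ∀ L : ℕ, ∑ j ∈ Finset.range L, ∑ i, F₀ i (k + j) ≤ r k ^ 2 / 2)
    {t : ℝ} (ht : t ∈ Icc 0 τ) (htc : t ≤ c)
    (htop : ∀ u ∈ Icc 0 t, ∀ i, F i (kLo + n - 1) u ≤ q (kLo + n - 1) ^ 2 / 2) :
    ∀ k : ℤ, kLo + n ≤ k → ∀ L : ℕ, ∀ u ∈ Icc 0 t,
      ∑ j ∈ Finset.range L, ∑ i, F i (k + j) u ≤ q k ^ 2 / 2 := by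
  intro k hk L u hu
  rcases eq_or_lt_of_le ht.1 with ht0 | ht0
  · -- t = 0: the flow is at its start state
    have hu0 : u = 0 := le_antisymm (ht0 ▸ hu.2) hu.1
    subst hu0
    obtain ⟨hr0, hrcq, hrec⟩ := hprof' k hk
    have hc0 : 0 ≤ c := ht0 ▸ htc
    have hρ0 : 0 ≤ ρ k := le_trans (by positivity) hrec
    have hrq : r k ≤ q k := by nlinarith
    have h1 : ∑ j ∈ Finset.range L, ∑ i, F i (k + j) 0 = ∑ j ∈ Finset.range L, ∑ i, F₀ i (k + j) := by
      simp_rw [hflow.init_F]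
    rw [h1]
    have h2 : r k ^ 2 / 2 ≤ q k ^ 2 / 2 := by nlinarith
    exact (hstart k hk L).trans h2
  · -- t > 0: restrict to [0, t] and run the one-directional induction there
    have hres := pseudoFlowOn_restrict hflow ht0 ht.2
    have hbase : ∀ u ∈ Icc 0 t, ∀ i, |S i (kLo + n - 1) u| ≤ q (kLo + n - 1) := by
      intro u hu i
      have h3 : S i (kLo + n - 1) u ^ 2 ≤ q (kLo + n - 1) ^ 2 := by
        linarith [hflow.defect_lower i (kLo + n - 1) u ⟨hu.1, hu.2.trans ht.2⟩, htop u hu i]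
      have h4 := abs_le_of_sq_le_sq' h3 hqtop
      exact abs_le.mpr ⟨h4.1, h4.2⟩
    have hK : kLo + n - 1 = kLo + n - 1 := rfl
    have := pseudoFlowOn_upper_tail_induction hres ht0 one_pos hα htc (kLo + n)
      (r := r) (q := q) (ρ := ρ) (fun k hk => ?_) (by simpa using hqtop) hstart
      (by simpa using hbase) k hk L u hu
    · exact this
    · obtain ⟨hr0, hrcq, hrec⟩ := hprof' k hk
      exact ⟨hr0, hrcq, by simpa using hrec⟩

end BarrierSoundness

end Summit.NavierStokesRegularity.NavierStokesRegularity.Theorems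

end
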